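import Mathlib
import Literature.Topology.FourManifolds.SmoothMax
import HarnessLib

/-!
# The tiny blob, I: the radial profile `η = h ∘ m` (flat at the centre, compactly supported, `|η + ση′| < 1`)

Cell `ns-blowup`, seat `ns-blowup-ecbridge-4` (g3); GROUP C «BRIDGE SUPPORT» of the route
`PalasekTowerBreakdown` (crux `EpisodeBaseG`, item stmt-NavierStokesRegularity-19179; negative lane:
`TinyAnchoredHosts`, `PalasekTowerRegisterGlobalSmallData.lean`). LABEL: E–C typing (KERNEL calculus:
five one-variable definitions with bodies and their elementary properties). WHAT THIS IS NOT: not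
Navier–Stokes evidence — one-variable calculus only; no flow, stage or schedule.

## What and why

The tiny-blob host of the negative lane is the field `B(y) = F(σ) e₃ − y₃ G(σ) y`, `σ = ‖y‖²`, with
`G = η′`, `F = η + σ η′` for a radial profile `η`. The blob must be smooth, compactly supported,
divergence free (automatic for this shape), have a UNIQUE speed maximum `‖B(0)‖ = 1` —
`‖B‖² ≤ max(F², η²)`, so we need `|η| < 1` and `|η + ση′| < 1` off `σ = 0` — and be FLAT at the centre
(`η′(0) = 0`, so that `DB(0) = 0`, `ΔB(0) = 0` and the weak anchor test of the pushed germ host holds).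
A cutoff built from `Real.smoothTransition` has no quantified slope, so a product `(1 − σ²) · cutoff`
cannot be shown to keep `|η + ση′| < 1`. The profile below avoids every unknown constant:

  `m(σ) = ∫₀^σ (1 − S(t − 1/2)) dt`  (the regularised `min(σ, 1)`: `m = σ` on `σ ≤ 1/2`, `m = 1` on
  `σ ≥ 3/2` since `∫₀¹ S = 1/2` by the symmetry `S(1 − x) = 1 − S(x)`, `0 ≤ m′ ≤ 1`, `m′` antitone, so
  `σ m′(σ) ≤ m(σ)`),  `h(m) = 1 − 3m² + 2m³ = (1 − m)²(1 + 2m)`,  `η = h ∘ m`.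

Then `η′ = h′(m) m′` with `h′ = −6m(1 − m) ≤ 0`, so `η + ση′ ∈ [h(m) + m h′(m), h(m)]` and
`h + m h′ = 1 − 9m² + 8m³ = 8(m − 3/4)²(m + 3/8) − 11/16 ≥ −11/16`; with `0 ≤ h(m) < 1` for
`m ∈ (0, 1]` this gives `|η| < 1`, `|η + ση′| < 1` for `σ > 0`. On the FLAT ZONE `σ ≤ 1/2`:
`η = 1 − 3σ² + 2σ³`, `G = −6σ + 6σ²`, `F = 1 − 9σ² + 8σ³` (polynomials — the core loop of the blob is
computed there).

* §1 `jcut`, `mramp` and their calculus; §2 `mramp = 1` on `[3/2, ∞)` (`∫₀¹ S = 1/2`, tree lemma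
  `Literature.Topology.FourManifolds.SmoothMax.integral_smoothTransition_zero_one`); §3 `hprof`, `etaProf`, `blobG`, `blobF`: derivatives, flat-zone formulas,
  values at `0`, vanishing on `[3/2, ∞)`, and the bounds `|etaProf| ≤ 1`, `|blobF| ≤ 1`, strict off `0`.

References: folklore one-variable calculus; the construction serves S. Palasek, arXiv:2605.13827 §3.3
(level-`0` host of a tower) [cite: Palasek2026ElementaryModel, §3.3].
-/

noncomputable section

namespace Summit.NavierStokesRegularity.FluidComputer.PalasekTowerClayBridge.TinyBlob

open Set Function Filter Topology MeasureTheory intervalIntegral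
open scoped Topology ContDiff

/-! ## §1 The regularised minimum `m` -/

/-- The integrand `j(t) = 1 − S(t − 1/2)` (`S` = `Real.smoothTransition`): `1` on `t ≤ 1/2`, `0` on
`t ≥ 3/2`, antitone, values in `[0, 1]`. [folklore] -/
def jcut (t : ℝ) : ℝ := 1 - Real.smoothTransition (t - 1 / 2)

/-- **The regularised minimum** `m(σ) = ∫₀^σ j`. [folklore] -/
def mramp (σ : ℝ) : ℝ := ∫ t in (0 : ℝ)..σ, jcut t

/-- `j` is smooth. [folklore] -/
theorem contDiff_jcut : ContDiff ℝ ∞ jcut :=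
  contDiff_const.sub (Real.smoothTransition.contDiff.comp (contDiff_id.sub contDiff_const))

/-- `j` is continuous. [folklore] -/
theorem continuous_jcut : Continuous jcut := contDiff_jcut.continuous

/-- `j = 1` on `(−∞, 1/2]`. [folklore] -/
theorem jcut_of_le_half {t : ℝ} (ht : t ≤ 1 / 2) : jcut t = 1 := by
  rw [jcut, Real.smoothTransition.zero_of_nonpos (by linarith), sub_zero]

/-- `j = 0` on `[3/2, ∞)`. [folklore] -/
theorem jcut_of_ge {t : ℝ} (ht : 3 / 2 ≤ t) : jcut t = 0 := by
  rw [jcut, Real.smoothTransition.one_of_one_le (by linarith), sub_self]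

/-- `0 ≤ j`. [folklore] -/
theorem jcut_nonneg (t : ℝ) : 0 ≤ jcut t := by
  have := Real.smoothTransition.le_one (t - 1 / 2); rw [jcut]; linarith

/-- `j ≤ 1`. [folklore] -/
theorem jcut_le_one (t : ℝ) : jcut t ≤ 1 := by
  have := Real.smoothTransition.nonneg (t - 1 / 2); rw [jcut]; linarith

/-- `j` is antitone. [folklore] -/
theorem jcut_antitone : Antitone jcut := fun a b hab => by
  have := Real.smoothTransition.monotone (show a - 1 / 2 ≤ b - 1 / 2 by linarith)
  simp only [jcut]; linarith

/-- `m′ = j`. [folklore] -/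
theorem hasDerivAt_mramp (σ : ℝ) : HasDerivAt mramp (jcut σ) σ :=
  integral_hasDerivAt_right (continuous_jcut.intervalIntegrable _ _)
    (continuous_jcut.stronglyMeasurableAtFilter _ _) continuous_jcut.continuousAt

/-- `deriv m = j`. [folklore] -/
theorem deriv_mramp : deriv mramp = jcut := funext fun σ => (hasDerivAt_mramp σ).deriv

/-- `m` is differentiable. [folklore] -/
theorem differentiable_mramp : Differentiable ℝ mramp := fun σ => (hasDerivAt_mramp σ).differentiableAt

/-- `m` is smooth. [folklore] -/
theorem contDiff_mramp : ContDiff ℝ ∞ mramp :=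
  contDiff_infty_iff_deriv.2 ⟨differentiable_mramp, by rw [deriv_mramp]; exact contDiff_jcut⟩

/-- `m` is continuous. [folklore] -/
theorem continuous_mramp : Continuous mramp := contDiff_mramp.continuous

/-- `m(0) = 0`. [folklore] -/
theorem mramp_zero : mramp 0 = 0 := by simp [mramp]

/-- **Flat zone**: `m(σ) = σ` for `σ ≤ 1/2` (the integrand is `1` on `(−∞, 1/2]`). [folklore] -/
theorem mramp_of_le_half {σ : ℝ} (hσ : σ ≤ 1 / 2) : mramp σ = σ := by
  rw [mramp]
  have h : ∀ t ∈ Set.uIcc (0 : ℝ) σ, jcut t = (fun _ => (1 : ℝ)) t := by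
    intro t ht
    rw [Set.uIcc_comm, Set.mem_uIcc] at ht
    rcases ht with ⟨_, h2⟩ | ⟨_, h2⟩
    · exact jcut_of_le_half (h2.trans (by norm_num))
    · exact jcut_of_le_half (h2.trans hσ)
  rw [integral_congr h, intervalIntegral.integral_const, smul_eq_mul, mul_one, sub_zero]

/-- `m` is monotone (`m′ = j ≥ 0`). [folklore] -/
theorem mramp_monotone : Monotone mramp :=
  monotone_of_deriv_nonneg differentiable_mramp fun σ => by rw [deriv_mramp]; exact jcut_nonneg σ

/-- `0 ≤ m(σ)` for `σ ≥ 0`. [folklore] -/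
theorem mramp_nonneg {σ : ℝ} (hσ : 0 ≤ σ) : 0 ≤ mramp σ := by
  rw [← mramp_zero]; exact mramp_monotone hσ

/-- `0 < m(σ)` for `σ > 0`. [folklore] -/
theorem mramp_pos {σ : ℝ} (hσ : 0 < σ) : 0 < mramp σ := by
  have h1 : mramp (min σ (1 / 2)) = min σ (1 / 2) := mramp_of_le_half (min_le_right _ _)
  have h2 : 0 < min σ (1 / 2) := lt_min hσ (by norm_num)
  have h3 : mramp (min σ (1 / 2)) ≤ mramp σ := mramp_monotone (min_le_left _ _)
  linarith

/-- `m(σ) ≤ σ` for `σ ≥ 0` (`j ≤ 1`). [folklore] -/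
theorem mramp_le_self {σ : ℝ} (hσ : 0 ≤ σ) : mramp σ ≤ σ := by
  rw [mramp]
  calc ∫ t in (0 : ℝ)..σ, jcut t ≤ ∫ _ in (0 : ℝ)..σ, (1 : ℝ) :=
        integral_mono_on hσ (continuous_jcut.intervalIntegrable _ _) (by simp)
          fun t _ => jcut_le_one t
    _ = σ := by simp

/-- **Concavity in use**: `σ j(σ) ≤ m(σ)` for `σ ≥ 0` (`j` is antitone on `[0, σ]`). [folklore] -/
theorem mul_jcut_le_mramp {σ : ℝ} (hσ : 0 ≤ σ) : σ * jcut σ ≤ mramp σ := by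
  rw [mramp]
  calc σ * jcut σ = ∫ _ in (0 : ℝ)..σ, jcut σ := by simp
    _ ≤ ∫ t in (0 : ℝ)..σ, jcut t :=
        integral_mono_on hσ (by simp) (continuous_jcut.intervalIntegrable _ _)
          fun t ht => jcut_antitone ht.2

/-! ## §2 The symmetry of the smooth transition and the plateau `m = 1` -/

/-- `m(3/2) = 1`: `∫₀^{3/2} (1 − S(t − 1/2)) dt = 3/2 − ∫_{−1/2}^{1} S = 3/2 − 1/2`. [folklore] -/
theorem mramp_three_halves : mramp (3 / 2) = 1 := by
  have hc : Continuous Real.smoothTransition := Real.smoothTransition.continuous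
  have hcs : Continuous fun t : ℝ => Real.smoothTransition (t - 1 / 2) := hc.comp (continuous_id.sub continuous_const)
  rw [mramp]
  have h1 : ∫ t in (0 : ℝ)..(3 / 2), jcut t = 3 / 2 - ∫ t in (0 : ℝ)..(3 / 2), Real.smoothTransition (t - 1 / 2) := by
    simp only [jcut]
    rw [integral_sub (by simp) (hcs.intervalIntegrable _ _)]
    simp
  have h2 : ∫ t in (0 : ℝ)..(3 / 2), Real.smoothTransition (t - 1 / 2) =
      ∫ u in (-(1 / 2) : ℝ)..1, Real.smoothTransition u := by
    rw [intervalIntegral.integral_comp_sub_right (fun u => Real.smoothTransition u) (1 / 2 : ℝ)]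
    norm_num
  have h3 : ∫ u in (-(1 / 2) : ℝ)..1, Real.smoothTransition u =
      (∫ u in (-(1 / 2) : ℝ)..0, Real.smoothTransition u) + ∫ u in (0 : ℝ)..1, Real.smoothTransition u :=
    (integral_add_adjacent_intervals (hc.intervalIntegrable _ _) (hc.intervalIntegrable _ _)).symm
  have h4 : ∫ u in (-(1 / 2) : ℝ)..0, Real.smoothTransition u = 0 := by
    have h : ∀ u ∈ Set.uIcc (-(1 / 2) : ℝ) 0, Real.smoothTransition u = (fun _ => (0 : ℝ)) u := by
      intro u hu
      rw [Set.mem_uIcc] at hu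
      rcases hu with ⟨_, h2⟩ | ⟨h1, _⟩
      · exact Real.smoothTransition.zero_of_nonpos h2
      · exact Real.smoothTransition.zero_of_nonpos (by linarith)
    rw [integral_congr h, intervalIntegral.integral_const, smul_zero]
  rw [h1, h2, h3, h4, Literature.Topology.FourManifolds.SmoothMax.integral_smoothTransition_zero_one]
  norm_num

/-- **Plateau**: `m(σ) = 1` for `σ ≥ 3/2` (the integrand vanishes beyond `3/2`). [folklore] -/
theorem mramp_of_ge {σ : ℝ} (hσ : 3 / 2 ≤ σ) : mramp σ = 1 := by
  have h1 : mramp σ = mramp (3 / 2) + ∫ t in (3 / 2 : ℝ)..σ, jcut t := by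
    rw [mramp, mramp]
    exact (integral_add_adjacent_intervals (continuous_jcut.intervalIntegrable _ _)
      (continuous_jcut.intervalIntegrable _ _)).symm
  have h2 : ∫ t in (3 / 2 : ℝ)..σ, jcut t = 0 := by
    have h : ∀ t ∈ Set.uIcc (3 / 2 : ℝ) σ, jcut t = (fun _ => (0 : ℝ)) t := by
      intro t ht
      rw [Set.uIcc_of_le hσ] at ht
      exact jcut_of_ge ht.1
    rw [integral_congr h, intervalIntegral.integral_const, smul_zero]
  rw [h1, h2, add_zero, mramp_three_halves]

/-- `m ≤ 1` everywhere. [folklore] -/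
theorem mramp_le_one (σ : ℝ) : mramp σ ≤ 1 := by
  rw [← mramp_of_ge (le_max_right σ (3 / 2))]
  exact mramp_monotone (le_max_left _ _)

/-! ## §3 The profile `η = h ∘ m`, its derivative `G` and the coefficient `F = η + σ G` -/

/-- The smoothstep `h(m) = 1 − 3m² + 2m³ = (1 − m)²(1 + 2m)`. [folklore] -/
def hprof (m : ℝ) : ℝ := 1 - 3 * m ^ 2 + 2 * m ^ 3

/-- **The radial profile** `η = h ∘ m`. [folklore] -/
def etaProf (σ : ℝ) : ℝ := hprof (mramp σ)

/-- **`G = η′`** `= h′(m) m′ = (−6m + 6m²) j`. [folklore] -/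
def blobG (σ : ℝ) : ℝ := (-6 * mramp σ + 6 * mramp σ ^ 2) * jcut σ

/-- **`F = η + σ η′`**, the `e₃`-coefficient of the blob. [folklore] -/
def blobF (σ : ℝ) : ℝ := etaProf σ + σ * blobG σ

/-- `η′ = G`. [folklore] -/
theorem hasDerivAt_etaProf (σ : ℝ) : HasDerivAt etaProf (blobG σ) σ := by
  have hh : HasDerivAt hprof (-6 * mramp σ + 6 * mramp σ ^ 2) (mramp σ) := by
    have hid := hasDerivAt_id (mramp σ)
    have h := (((hid.pow 2).const_mul 3).const_sub 1).add ((hid.pow 3).const_mul 2)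
    have hfun : hprof = fun y => 1 - 3 * id y ^ 2 + 2 * id y ^ 3 := by
      funext y; simp [hprof]
    rw [hfun]
    refine h.congr_deriv ?_
    simp only [id_eq, Nat.cast_ofNat]
    ring
  exact hh.comp σ (hasDerivAt_mramp σ)

/-- `deriv η = G`. [folklore] -/
theorem deriv_etaProf : deriv etaProf = blobG := funext fun σ => (hasDerivAt_etaProf σ).deriv

/-- `η`, `G`, `F` are smooth. [folklore] -/
theorem contDiff_etaProf : ContDiff ℝ ∞ etaProf := by
  have hh : ContDiff ℝ ∞ hprof := by unfold hprof; fun_prop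
  exact hh.comp contDiff_mramp

/-- `G` is smooth. [folklore] -/
theorem contDiff_blobG : ContDiff ℝ ∞ blobG := by
  unfold blobG
  exact ((contDiff_const.mul contDiff_mramp).add (contDiff_const.mul (contDiff_mramp.pow 2))).mul
    contDiff_jcut

/-- `F` is smooth. [folklore] -/
theorem contDiff_blobF : ContDiff ℝ ∞ blobF :=
  contDiff_etaProf.add (contDiff_id.mul contDiff_blobG)

/-- **The derivative of `F`**: `F′ = 2G + σ G′`. [folklore] -/
theorem hasDerivAt_blobF (σ : ℝ) : HasDerivAt blobF (2 * blobG σ + σ * deriv blobG σ) σ := by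
  have hG : HasDerivAt blobG (deriv blobG σ) σ :=
    (contDiff_blobG.differentiable (by simp) σ).hasDerivAt
  have h : HasDerivAt (fun x => etaProf x + x * blobG x) (blobG σ + (1 * blobG σ + σ * deriv blobG σ)) σ :=
    (hasDerivAt_etaProf σ).add ((hasDerivAt_id σ).mul hG)
  have h2 : blobG σ + (1 * blobG σ + σ * deriv blobG σ) = 2 * blobG σ + σ * deriv blobG σ := by ring
  rw [h2] at h
  exact h

/-! ### Flat-zone formulas, values at the centre, vanishing far out -/

/-- On `σ ≤ 1/2`: `η = 1 − 3σ² + 2σ³`. [folklore] -/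
theorem etaProf_of_le_half {σ : ℝ} (hσ : σ ≤ 1 / 2) : etaProf σ = 1 - 3 * σ ^ 2 + 2 * σ ^ 3 := by
  rw [etaProf, hprof, mramp_of_le_half hσ]

/-- On `σ ≤ 1/2`: `G = −6σ + 6σ²`. [folklore] -/
theorem blobG_of_le_half {σ : ℝ} (hσ : σ ≤ 1 / 2) : blobG σ = -6 * σ + 6 * σ ^ 2 := by
  rw [blobG, mramp_of_le_half hσ, jcut_of_le_half hσ, mul_one]

/-- On `σ ≤ 1/2`: `F = 1 − 9σ² + 8σ³`. [folklore] -/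
theorem blobF_of_le_half {σ : ℝ} (hσ : σ ≤ 1 / 2) : blobF σ = 1 - 9 * σ ^ 2 + 8 * σ ^ 3 := by
  rw [blobF, etaProf_of_le_half hσ, blobG_of_le_half hσ]; ring

/-- `η(0) = 1`. [folklore] -/
theorem etaProf_zero : etaProf 0 = 1 := by rw [etaProf_of_le_half (by norm_num)]; norm_num

/-- `G(0) = 0` (FLATNESS: `η′(0) = 0`). [folklore] -/
theorem blobG_zero : blobG 0 = 0 := by rw [blobG_of_le_half (by norm_num)]; norm_num

/-- `F(0) = 1`. [folklore] -/
theorem blobF_zero : blobF 0 = 1 := by rw [blobF_of_le_half (by norm_num)]; norm_num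

/-- `F′(0) = 0`. [folklore] -/
theorem deriv_blobF_zero : deriv blobF 0 = 0 := by
  rw [(hasDerivAt_blobF 0).deriv, blobG_zero]; ring

/-- `η = 0` on `[3/2, ∞)`. [folklore] -/
theorem etaProf_of_ge {σ : ℝ} (hσ : 3 / 2 ≤ σ) : etaProf σ = 0 := by
  rw [etaProf, hprof, mramp_of_ge hσ]; norm_num

/-- `G = 0` on `[3/2, ∞)`. [folklore] -/
theorem blobG_of_ge {σ : ℝ} (hσ : 3 / 2 ≤ σ) : blobG σ = 0 := by
  rw [blobG, mramp_of_ge hσ]; norm_num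

/-- `F = 0` on `[3/2, ∞)`. [folklore] -/
theorem blobF_of_ge {σ : ℝ} (hσ : 3 / 2 ≤ σ) : blobF σ = 0 := by
  rw [blobF, etaProf_of_ge hσ, blobG_of_ge hσ]; ring

/-! ### The bounds `|η| ≤ 1`, `|F| ≤ 1`, strict off the centre -/

/-- `0 ≤ h(m) ≤ 1` on `[0, 1]`, `h(m) < 1` for `m ∈ (0, 1]` (`1 − h = m²(3 − 2m)`). [folklore] -/
theorem hprof_bounds {m : ℝ} (h0 : 0 ≤ m) (h1 : m ≤ 1) : 0 ≤ hprof m ∧ hprof m ≤ 1 := by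
  unfold hprof; constructor <;> nlinarith [sq_nonneg m, sq_nonneg (1 - m), mul_nonneg h0 (sq_nonneg (1 - m))]

/-- `h(m) < 1` for `0 < m ≤ 1`. [folklore] -/
theorem hprof_lt_one {m : ℝ} (h0 : 0 < m) (h1 : m ≤ 1) : hprof m < 1 := by
  unfold hprof; nlinarith [sq_nonneg m, mul_pos h0 h0, mul_pos (mul_pos h0 h0) h0]

/-- `h(m) + m h′(m) = 1 − 9m² + 8m³ ≥ −11/16` on `[0, ∞)` (`= 8(m − 3/4)²(m + 3/8) − 11/16`). [folklore] -/
theorem hprof_add_mul_deriv_ge {m : ℝ} (h0 : 0 ≤ m) : -(11 / 16) ≤ 1 - 9 * m ^ 2 + 8 * m ^ 3 := by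
  nlinarith [sq_nonneg (m - 3 / 4), mul_nonneg (sq_nonneg (m - 3 / 4)) (by linarith : (0 : ℝ) ≤ m + 3 / 8)]

/-- `0 ≤ η ≤ 1` on `[0, ∞)`. [folklore] -/
theorem etaProf_mem {σ : ℝ} (hσ : 0 ≤ σ) : 0 ≤ etaProf σ ∧ etaProf σ ≤ 1 :=
  hprof_bounds (mramp_nonneg hσ) (mramp_le_one σ)

/-- **`η < 1` off the centre.** [folklore] -/
theorem etaProf_lt_one {σ : ℝ} (hσ : 0 < σ) : etaProf σ < 1 :=
  hprof_lt_one (mramp_pos hσ) (mramp_le_one σ)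

/-- **`−11/16 ≤ F ≤ η` on `[0, ∞)`**: `F = h(m) + (σ j) h′(m)` with `h′(m) = −6m(1−m) ≤ 0` and
`0 ≤ σ j ≤ m`. [folklore] -/
theorem blobF_mem {σ : ℝ} (hσ : 0 ≤ σ) : -(11 / 16) ≤ blobF σ ∧ blobF σ ≤ etaProf σ := by
  have hm0 : 0 ≤ mramp σ := mramp_nonneg hσ
  have hm1 : mramp σ ≤ 1 := mramp_le_one σ
  have hj0 : 0 ≤ σ * jcut σ := mul_nonneg hσ (jcut_nonneg σ)
  have hjm : σ * jcut σ ≤ mramp σ := mul_jcut_le_mramp hσ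
  have hh' : -6 * mramp σ + 6 * mramp σ ^ 2 ≤ 0 := by nlinarith
  have hF : blobF σ = hprof (mramp σ) + (σ * jcut σ) * (-6 * mramp σ + 6 * mramp σ ^ 2) := by
    rw [blobF, etaProf, blobG]; ring
  have hlow := hprof_add_mul_deriv_ge hm0
  constructor
  · rw [hF, hprof]
    -- `(σ j) h′ ≥ m h′` since `h′ ≤ 0` and `σ j ≤ m`
    have : mramp σ * (-6 * mramp σ + 6 * mramp σ ^ 2) ≤ (σ * jcut σ) * (-6 * mramp σ + 6 * mramp σ ^ 2) :=
      mul_le_mul_of_nonpos_right hjm hh'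
    nlinarith
  · rw [hF, etaProf]
    nlinarith [mul_nonpos_of_nonneg_of_nonpos hj0 hh']

/-- `|η| ≤ 1` on `[0, ∞)`. [folklore] -/
theorem abs_etaProf_le {σ : ℝ} (hσ : 0 ≤ σ) : |etaProf σ| ≤ 1 := by
  rw [abs_le]; have := etaProf_mem hσ; constructor <;> linarith

/-- `|F| ≤ 1` on `[0, ∞)`. [folklore] -/
theorem abs_blobF_le {σ : ℝ} (hσ : 0 ≤ σ) : |blobF σ| ≤ 1 := by
  rw [abs_le]; have := blobF_mem hσ; have := etaProf_mem hσ; constructor <;> linarith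

/-- **`|F| < 1` off the centre.** [folklore] -/
theorem abs_blobF_lt {σ : ℝ} (hσ : 0 < σ) : |blobF σ| < 1 := by
  rw [abs_lt]; have := blobF_mem hσ.le; have := etaProf_lt_one hσ; constructor <;> linarith

/-- `η² ≤ 1` and `F² ≤ 1` on `[0, ∞)`; both `< 1` off the centre — packaged as `max (F²) (η²)`.
[folklore] -/
theorem max_sq_le_one {σ : ℝ} (hσ : 0 ≤ σ) : max (blobF σ ^ 2) (etaProf σ ^ 2) ≤ 1 := by
  have h1 := abs_blobF_le hσ
  have h2 := abs_etaProf_le hσ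
  refine max_le ?_ ?_
  · have := sq_le_sq' (abs_le.1 h1).1 (abs_le.1 h1).2; simpa using this
  · have := sq_le_sq' (abs_le.1 h2).1 (abs_le.1 h2).2; simpa using this

/-- … strictly below `1` off the centre. [folklore] -/
theorem max_sq_lt_one {σ : ℝ} (hσ : 0 < σ) : max (blobF σ ^ 2) (etaProf σ ^ 2) < 1 := by
  have h1 := abs_blobF_lt hσ
  have h2 : |etaProf σ| < 1 := by
    rw [abs_lt]; have := etaProf_mem hσ.le; have := etaProf_lt_one hσ; constructor <;> linarith
  refine max_lt ?_ ?_
  · have := sq_lt_sq' (abs_lt.1 h1).1 (abs_lt.1 h1).2; simpa using this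
  · have := sq_lt_sq' (abs_lt.1 h2).1 (abs_lt.1 h2).2; simpa using this

end Summit.NavierStokesRegularity.FluidComputer.PalasekTowerClayBridge.TinyBlob

end
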